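import Summits.QuantumFields.BalabanUV.Beta.GAN24.RespStepBm
import Summits.QuantumFields.BalabanUV.Beta.GAN24.RespStepBmGaugeLaw
import Summits.QuantumFields.BalabanUV.Beta.GAN24.Push4Iter

/-!
# `BalabanUV.Beta.GAN24.RespStepBmDecomp` — binder row G-an2-4 / (CONV-C), S-slot road «SREC» (row owner gan24-p1's `SKELETON-SREC.md` v0.3 SR-L4a ∕
# PART V row V4-c; RULINGS-16 addendum (R16-3) «SREC-DECOMP», journal `CLAIMS.log` l.18387, claim l.18444), PART 1 OF 2:
# THE ACTION `legAct` OF LEG FAMILIES ON COARSE DATA, ITS FUBINI LAWS, THE DRESSED LEGS THROUGH THE PROJECTOR, AND THE EXACT TRANSPORT OF A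
# PURE-GAUGE DATUM THROUGH THE CHAIN OF DRESSED ONE-STEP LEGS — `legAct (legChain D m k) (dz ψ) = ((Lc:ℝ)^((d+1)(k+1)))⁻¹ • dz (ψ ∘ blk (Lc^(k+1)))`

NOT IN PRINT; OUR BOOKKEEPING (G-an2-4 formalisation swarm, leaf prover `b2b-balaban-gan24-formalise-leaf-01`, gen 44, taking the row owner's idle-seat
invitation (R16-3); names PROVISIONAL — the owner may rename ∕ re-cut; part 2 = `GAN24/RespStepBmDecompPsi` (the accumulated gauge `Ψ` and THE
DECOMPOSITION `T_{m→n} = Π_m ∘ respStep (Lc^m) (Lc^n) + dz ∘ Ψ_{m,n}`)).  HONEST FRAMING (cell contract, verbatim): «discharging `BetaPertH` makes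
Bałaban's UV stability UNCONDITIONAL — a real constructive-QFT result; it is NOT the continuum limit and NOT the Clay problem.»  HONEST DEPENDENCY
(verbatim): «continuum YM on T⁴ ⇐ BetaPertH ∧ nine spine estimates (0/9 proved); BetaPertH ⇐ (D1) ∧ (D4) ∧ CAP+tail; G-an2-4 gates asym, D1 and NE2/3/4.»

WHY (the owner's DESIGN CORRECTION l.18293 (C2) and `S-REC-SIZING.md` v2, locator — not a premise).  The cubic line of the (E) recursion reads the
CO-DRESSED step resolvents, whose legs are the dressed one-step response families `D j := respStepBm ρ Lc (Lc^j) (Lc^(j+1)) = Π^ρ_bm ∘ respStep (Lc^j) (Lc^(j+1))`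
(leaf-01's `RespStepBm`, gan24-p4's `AxProjBmWindow` ∕ `RespStepBmGaugeStep` ∕ `RespStepBmGaugeLaw`); their iterates along the tower are the `legComp`-chains
`legChain D m k` (leaf-17's `Push4Iter`).  Row V4-c asks for the CLOSED FORM of these chains as operators on coarse 1-forms: the projector at each intermediate level
removes a pure gauge `dz (bmGaugeAt …)`, and a pure gauge is transported by every further dressed leg EXACTLY, with the level-free factor `(Lc^{d+1})⁻¹` and no
memory of the minimiser (gan24-p4's `dressedLeg_KStepUnit_exact_eq`, the owner's O13-1 constant).  THIS part types the operator `legAct` and proves the exact transport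
through the whole chain; part 2 assembles the decomposition.

WHAT ([folklore] throughout; ONE plumbing definition `legAct`; generic dimension `d+1`; in-block root `ρ = toSite rr`, `rr ∈ box (d+1) Lc`; `1 ≤ Lc` via `[NeZero Lc]`):
* §0 two summability bricks: `tsum_abs_le_of_legDecay` (the fine-variable `ℓ¹` norm of a leg with `LegDecay r N C m`, `0 < m`, is `≤ C · Zl (d+1) m` UNIFORMLY in
  the coarse bond) and `summable_comp_blk'` (signed twin of an1's `AxialDressing.summable_comp_blk`).
* §1 `legAct r b κ u := Σ_μ Σ'_y b μ y · r μ y κ u` (the fine 1-form obtained by superposing the legs with coarse weights); `legAct_smul` ∕ `legAct_neg` ∕ `legAct_sub`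
  (bounded legs, summable data); `legAct_respStep_self` (leaf-12's identity leg `respStep M M` acts as the identity); **`summable_legAct`** (a localised leg maps
  `ℓ¹` data to `ℓ¹` fields — Mathlib's `summable_prod_of_nonneg` on the majorant `|b μ y|·|r μ y κ u|`); **`legAct_legComp`**: `legAct (legComp r₂ r₁) b =
  legAct r₂ (legAct r₁ b)` for `r₁` localised at a positive rate, `r₂` bounded, `b` summable (Fubini, `Summable.tsum_comm`).
* §2 **`legAct_bmW`**: `legAct (bmW ρ L R) b = axProjBmAt ρ L (legAct R b)` (bounded `R`, summable `b`; gan24-p4's `sum_tsum_mul_coProjBmW` + `axProjBmAt_eq_coProjBmW'`).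
* §3 **`legAct_respStepBm_dz`**: `legAct (respStepBm ρ Lc (Lc^m) (Lc^(m+1))) (dz ψ) = ((Lc:ℝ)^(d+1))⁻¹ • dz (fun x => ψ (blk Lc x))` for summable `ψ` (gan24-p4's
  `RespStepBmGaugeLaw.dressedStep_exact_eq` read in this vocabulary); `legDecay_respStepBm_levels` (leaf-01's `legDecay_bmW`); **`legAct_respStep_succ`**:
  `legAct (respStep (Lc^i) (Lc^n)) (legAct (respStep (Lc^n) (Lc^(n+1))) b) = legAct (respStep (Lc^i) (Lc^(n+1))) b` (§1 + leaf-12's `legComp_respStep`).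
* §4 **`legAct_legChain_dz`**: `legAct (legChain D m₀ k) (dz ψ) = ((Lc:ℝ)^((d+1)(k+1)))⁻¹ • dz (fun x => ψ (blk (Lc^(k+1)) x))` (induction on `k` at the source end;
  `blk_blk : blk L (blk M x) = blk (M·L) x`).
HYPOTHESES.  Besides the in-block root and summability of the data, §3–§4 (and part 2) take the LEVELWISE LOCALISATION of the UNDRESSED one-step response families
`hD : ∀ j, ∃ C m, 0 < m ∧ LegDecay (respStep (Lc^j) (Lc^(j+1))) Lc C m` — used ONLY qualitatively (summability ∕ Fubini ∕ boundedness of the chains via leaf-17's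
`legDecay_legChain`), never with its constants; it follows from the K-slot's decay `Decays K̃_j C m` by leaf-12's `colH_KStepUnit` (part 2 §7), and at `d = 3` from
gan24-p1's `RespStepDecay` (NOT imported: no `d`-restriction here).  0 cited facts, 0 `def … : Prop`, 0 sorry.  NO estimate, NO rate, NO wall binder; asserts NO shape of
Bałaban's stencils; discharges NOTHING of (hS, hSall) on (E); the owner's reserved ESTIMATE rows (`RespStepBmDecay*`) untouched; NEVER «G-an2-4 closed»; NOT D1, NOT
BetaPertH, NOT continuum, NOT Clay.
-/

noncomputable section

open Finset
open scoped BigOperators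
open Literature.MathematicalPhysics.QuantumFieldTheory
open Literature.MathematicalPhysics.QuantumFieldTheory.Balaban1983to89
open Literature.MathematicalPhysics.QuantumFieldTheory.Balaban1983to89.Beta
open B12Sec2to5 (l1 l1_nonneg)
open ExpKernelCalculus (Zl Zl_nonneg tsum_exp_shift' summable_exp_shift')
open AffineAveraging (Form0 Form1 Site box toSite unitVec dz blockSum)
open AveragingContours (blk grad grad_eq_dz blk_block axial)
open AxialProjector (zsmul_blk_le lt_zsmul_blk_add blk_eq_of_mem_block)
open AxialDressing (blockMass blockMass_nonneg summable_blockMass abs_le_blockMass summable_comp_blk)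
open KKTFluctuationEnergy (summable_mul_of_bdd summable_mul_of_bdd' summable_dz)
open BalabanCompositeJets (respStep)
open Summit.QuantumFields.BalabanUV.Beta.AxialProjectorBlockMean (blockMeanAt bmGaugeAt axProjBmAt)
open Summit.QuantumFields.BalabanUV.Beta.AxialDressingRooted (coProjBmW)
open Summit.QuantumFields.BalabanUV.Beta.GAN24.AxProjBmWindow (axProjBmAt_eq_coProjBmW')
open Summit.QuantumFields.BalabanUV.Beta.GAN24.RespStepBmGaugeStep (exists_abs_respStep_le sum_tsum_mul_coProjBmW)
open Summit.QuantumFields.BalabanUV.Beta.GAN24.RespStepBmGaugeLaw (dressedStep_exact_eq)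
open Summit.QuantumFields.BalabanUV.Beta.GAN24.Push4 (legComp legComp_apply)
open Summit.QuantumFields.BalabanUV.Beta.GAN24.Push4Bounds (LegDecay LegDecay.nonneg LegDecay.abs_le LegDecay.summable)
open Summit.QuantumFields.BalabanUV.Beta.GAN24.Push4Iter (LegFam legChain legChain_zero legChain_succ legDecay_legChain)
open Summit.QuantumFields.BalabanUV.Beta.GAN24.RespStepSemigroup (respStep_self legComp_respStep)
open Summit.QuantumFields.BalabanUV.Beta.GAN24.RespStepBm (bmW bmW_apply respStepBm respStepBm_def legDecay_bmW)

namespace Summit.QuantumFields.BalabanUV.Beta.GAN24.RespStepBmDecomp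

variable {d : ℕ}

/-! ## §0 Two summability bricks -/

/-- [folklore] **THE FINE-VARIABLE `ℓ¹` NORM OF A LOCALISED LEG IS UNIFORM IN THE COARSE BOND**: `LegDecay r N C m`, `0 < m` ⟹
`Σ'_u |r μ y κ u| ≤ C · Zl (d+1) m`. -/
theorem tsum_abs_le_of_legDecay {r : LegFam d} {N : ℕ} {C m : ℝ} (hr : LegDecay r N C m) (hm : 0 < m) (μ : Fin (d + 1))
    (y : Fin (d + 1) → ℤ) (κ : Fin (d + 1)) : ∑' u, |r μ y κ u| ≤ C * Zl (d + 1) m := by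
  rw [← tsum_exp_shift' (c := m) ((N : ℤ) • y), ← tsum_mul_left]
  exact Summable.tsum_le_tsum (fun u => hr μ y κ u) (hr.summable hm μ y κ).abs ((summable_exp_shift' hm _).mul_left C)

/-- [folklore] A summable coarse function read through the block index is summable (signed version of `AxialDressing.summable_comp_blk`). -/
theorem summable_comp_blk' {L : ℕ} (hL : 1 ≤ L) {ψ : Site (d + 1) → ℝ} (hψ : Summable ψ) :
    Summable fun x : Site (d + 1) => ψ (blk L x) := by
  refine Summable.of_norm_bounded (summable_comp_blk hL hψ.abs (fun c => abs_nonneg _)) (fun x => ?_)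
  rw [Real.norm_eq_abs]

/-! ## §1 The action of a leg family on a coarse datum: `legAct r b (κ, u) = Σ_μ Σ'_y b μ y · r μ y κ u` -/

/-- [our object] **THE ACTION OF A LEG FAMILY ON A COARSE 1-FORM**: `legAct r b κ u := Σ_μ Σ'_y b μ y · r μ y κ u` — the fine 1-form obtained by
superposing the legs `r μ y` with the coarse weights `b μ y` (for `r = respStep M N′` and `b = dz ψ`: the `M`-contour sums of the minimiser response
to the pure gauge `d_c ψ`). -/
def legAct (r : LegFam d) (b : Form1 (d + 1) ℝ) : Form1 (d + 1) ℝ := fun κ u => ∑ μ, ∑' y, b μ y * r μ y κ u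

/-- [folklore] `legAct`, by `rfl`. -/
theorem legAct_apply (r : LegFam d) (b : Form1 (d + 1) ℝ) (κ : Fin (d + 1)) (u : Fin (d + 1) → ℤ) :
    legAct r b κ u = ∑ μ, ∑' y, b μ y * r μ y κ u := rfl

/-- [folklore] Scalars come out of the datum. -/
theorem legAct_smul (r : LegFam d) (c : ℝ) (b : Form1 (d + 1) ℝ) : legAct r (c • b) = c • legAct r b := by
  funext κ u
  simp only [legAct_apply, Pi.smul_apply, smul_eq_mul, Finset.mul_sum, ← tsum_mul_left, mul_assoc]

/-- [folklore] Signs come out of the leg. -/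
theorem legAct_neg (r : LegFam d) (b : Form1 (d + 1) ℝ) : legAct (-r) b = -legAct r b := by
  funext κ u
  simp only [legAct_apply, Pi.neg_apply, mul_neg, tsum_neg, Finset.sum_neg_distrib]

/-- [folklore] The action of a BOUNDED leg family is additive on SUMMABLE data (differences). -/
theorem legAct_sub {r : LegFam d} {C : ℝ} (hr : ∀ μ y κ u, |r μ y κ u| ≤ C) {b₁ b₂ : Form1 (d + 1) ℝ} (h₁ : ∀ μ, Summable (b₁ μ))
    (h₂ : ∀ μ, Summable (b₂ μ)) : legAct r (b₁ - b₂) = legAct r b₁ - legAct r b₂ := by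
  funext κ u
  simp only [legAct_apply, Pi.sub_apply, sub_mul, ← Finset.sum_sub_distrib]
  refine Finset.sum_congr rfl fun μ _ => ?_
  exact (summable_mul_of_bdd' (h₁ μ) fun y => hr μ y κ u).tsum_sub (summable_mul_of_bdd' (h₂ μ) fun y => hr μ y κ u)

/-- [folklore] **THE IDENTITY LEG ACTS AS THE IDENTITY**: `legAct (respStep M M) b = b` (leaf-12's `respStep_self`; no summability needed). -/
theorem legAct_respStep_self (M : ℕ) [NeZero M] (b : Form1 (d + 1) ℝ) : legAct (respStep (d := d) M M) b = b := by
  funext κ u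
  simp only [legAct_apply, respStep_self]
  have e : ∀ μ : Fin (d + 1), (∑' y, b μ y * (if u = y ∧ κ = μ then (1 : ℝ) else 0)) = if μ = κ then b μ u else 0 := by
    intro μ
    rw [tsum_eq_single u (fun y hy => by rw [if_neg (fun h => hy h.1.symm), mul_zero])]
    by_cases hμ : μ = κ
    · rw [if_pos ⟨rfl, hμ.symm⟩, mul_one, if_pos hμ]
    · rw [if_neg (fun h => hμ h.2.symm), mul_zero, if_neg hμ]
  simp only [e, Finset.sum_ite_eq', Finset.mem_univ, if_true]

/-- [folklore] **A LOCALISED LEG MAPS `ℓ¹` DATA TO `ℓ¹` FIELDS**: `LegDecay r N C m` (`0 < m`), `∀ μ, Summable (b μ)` ⟹ `∀ κ, Summable (legAct r b κ)`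
(Fubini for the nonnegative majorant `|b μ y| · |r μ y κ u|`, whose `u`-sums are uniform in `y` by `tsum_abs_le_of_legDecay`). -/
theorem summable_legAct {r : LegFam d} {N : ℕ} {C m : ℝ} (hr : LegDecay r N C m) (hm : 0 < m) {b : Form1 (d + 1) ℝ}
    (hb : ∀ μ, Summable (b μ)) (κ : Fin (d + 1)) : Summable (legAct r b κ) := by
  have hF : ∀ μ : Fin (d + 1), Summable (fun u : Fin (d + 1) → ℤ => ∑' y, |b μ y| * |r μ y κ u|) := by
    intro μ
    have hf : Summable (fun p : (Fin (d + 1) → ℤ) × (Fin (d + 1) → ℤ) => |b μ p.1| * |r μ p.1 κ p.2|) := by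
      refine (summable_prod_of_nonneg (fun p => mul_nonneg (abs_nonneg _) (abs_nonneg _))).2 ⟨fun y => ?_, ?_⟩
      · dsimp only
        exact ((hr.summable hm μ y κ).abs).mul_left _
      · dsimp only
        refine Summable.of_nonneg_of_le (fun y => tsum_nonneg fun u => mul_nonneg (abs_nonneg _) (abs_nonneg _)) (fun y => ?_)
          (((hb μ).abs).mul_right (C * Zl (d + 1) m))
        rw [tsum_mul_left]
        exact mul_le_mul_of_nonneg_left (tsum_abs_le_of_legDecay hr hm μ y κ) (abs_nonneg _)
    have hf' : Summable (fun p : (Fin (d + 1) → ℤ) × (Fin (d + 1) → ℤ) => |b μ p.2| * |r μ p.2 κ p.1|) := by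
      have h2 := hf.prod_symm
      simpa only [Prod.fst_swap, Prod.snd_swap] using h2
    exact hf'.prod
  refine Summable.of_norm_bounded (g := fun u => ∑ μ : Fin (d + 1), ∑' y, |b μ y| * |r μ y κ u|)
    (summable_sum fun μ _ => hF μ) (fun u => ?_)
  rw [Real.norm_eq_abs, legAct_apply]
  refine (Finset.abs_sum_le_sum_abs _ _).trans (Finset.sum_le_sum fun μ _ => ?_)
  have hs : Summable fun y => b μ y * r μ y κ u := summable_mul_of_bdd' (hb μ) (fun y => hr.abs_le hm.le μ y κ u)
  have h := norm_tsum_le_tsum_norm hs.norm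
  simpa only [Real.norm_eq_abs, abs_mul] using h

/-- [folklore] **COMPOSITE LEGS ACT BY COMPOSITION** (Fubini): for an inner leg `r₁` localised at a positive rate, an outer leg `r₂` bounded, and summable data,
`legAct (legComp r₂ r₁) b = legAct r₂ (legAct r₁ b)` (leaf-17's `legComp`: first `r₁` from the coarse bond, then `r₂`). -/
theorem legAct_legComp {r₁ r₂ : LegFam d} {N₁ : ℕ} {C₁ m₁ C₂ : ℝ} (h₁ : LegDecay r₁ N₁ C₁ m₁) (hm₁ : 0 < m₁)
    (h₂ : ∀ lam v κ u, |r₂ lam v κ u| ≤ C₂) {b : Form1 (d + 1) ℝ} (hb : ∀ μ, Summable (b μ)) :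
    legAct (legComp r₂ r₁) b = legAct r₂ (legAct r₁ b) := by
  funext κ u
  have hC₂ : 0 ≤ C₂ := (abs_nonneg _).trans (h₂ 0 0 0 0)
  -- the triple products and their summability on the product `(y, v)`
  set G : Fin (d + 1) → Fin (d + 1) → (Fin (d + 1) → ℤ) → (Fin (d + 1) → ℤ) → ℝ :=
    fun μ lam y v => b μ y * (r₁ μ y lam v * r₂ lam v κ u) with hG
  have hGs : ∀ μ lam, Summable (Function.uncurry (G μ lam)) := by
    intro μ lam
    have hmaj : Summable (fun p : (Fin (d + 1) → ℤ) × (Fin (d + 1) → ℤ) => |b μ p.1| * (|r₁ μ p.1 lam p.2| * C₂)) := by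
      refine (summable_prod_of_nonneg (fun p => by positivity)).2 ⟨fun y => ?_, ?_⟩
      · dsimp only
        exact (((h₁.summable hm₁ μ y lam).abs).mul_right C₂).mul_left _
      · dsimp only
        refine Summable.of_nonneg_of_le (fun y => tsum_nonneg fun v => by positivity) (fun y => ?_)
          (((hb μ).abs).mul_right (C₁ * Zl (d + 1) m₁ * C₂))
        rw [tsum_mul_left, tsum_mul_right]
        exact mul_le_mul_of_nonneg_left (mul_le_mul_of_nonneg_right (tsum_abs_le_of_legDecay h₁ hm₁ μ y lam) hC₂) (abs_nonneg _)
    refine Summable.of_norm_bounded hmaj (fun p => ?_)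
    simp only [Function.uncurry, hG, Real.norm_eq_abs, abs_mul]
    exact mul_le_mul_of_nonneg_left (mul_le_mul_of_nonneg_left (h₂ _ _ _ _) (abs_nonneg _)) (abs_nonneg _)
  -- LEFT: `Σ_μ Σ'_y b μ y · Σ'_v Σ_λ r₁ r₂ = Σ_μ Σ_λ Σ'_y Σ'_v G`
  have lhs : legAct (legComp r₂ r₁) b κ u = ∑ μ, ∑ lam, ∑' y, ∑' v, G μ lam y v := by
    rw [legAct_apply]
    refine Finset.sum_congr rfl fun μ _ => ?_
    have e : ∀ y, b μ y * legComp r₂ r₁ μ y κ u = ∑ lam, ∑' v, G μ lam y v := by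
      intro y
      rw [legComp_apply, ← tsum_mul_left]
      have e1 : ∀ v, b μ y * ∑ lam, r₁ μ y lam v * r₂ lam v κ u = ∑ lam, G μ lam y v := by
        intro v; rw [Finset.mul_sum]
      simp_rw [e1]
      exact Summable.tsum_finsetSum fun lam _ => (hGs μ lam).prod_factor y
    simp_rw [e]
    exact Summable.tsum_finsetSum fun lam _ => (hGs μ lam).prod
  -- RIGHT: `Σ_λ Σ'_v (Σ_μ Σ'_y b r₁) · r₂ = Σ_λ Σ_μ Σ'_v Σ'_y G`
  have rhs : legAct r₂ (legAct r₁ b) κ u = ∑ lam, ∑ μ, ∑' v, ∑' y, G μ lam y v := by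
    rw [legAct_apply]
    refine Finset.sum_congr rfl fun lam _ => ?_
    have e : ∀ v, legAct r₁ b lam v * r₂ lam v κ u = ∑ μ, ∑' y, G μ lam y v := by
      intro v
      rw [legAct_apply, Finset.sum_mul]
      refine Finset.sum_congr rfl fun μ _ => ?_
      rw [← tsum_mul_right]
      exact tsum_congr fun y => by simp only [hG]; ring
    simp_rw [e]
    exact Summable.tsum_finsetSum fun μ _ => (hGs μ lam).prod_symm.prod
  rw [lhs, rhs, Finset.sum_comm]
  refine Finset.sum_congr rfl fun lam _ => Finset.sum_congr rfl fun μ _ => ?_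
  exact ((hGs μ lam).tsum_comm).symm

/-! ## §2 The dressed legs act through the projector: `legAct (bmW ρ L R) b = Π^ρ_bm (legAct R b)` -/

/-- [folklore] **THE WINDOWED LEGS ACT THROUGH THE PROJECTOR** (in-block root `ρ = toSite rr`, `1 ≤ L`, bounded legs, summable data):
`legAct (bmW ρ L R) b = axProjBmAt ρ L (legAct R b)` — gan24-p4's `sum_tsum_mul_coProjBmW` (the finite window sums come out of the series) and
`axProjBmAt_eq_coProjBmW'` (`Π^ρ_bm` IS its window matrix). -/
theorem legAct_bmW {L : ℕ} (hL : 1 ≤ L) {rr : Fin (d + 1) → ℕ} (hrr : rr ∈ box (d + 1) L) {R : LegFam d} {C : ℝ}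
    (hR : ∀ μ y κ u, |R μ y κ u| ≤ C) {b : Form1 (d + 1) ℝ} (hb : ∀ μ, Summable (b μ)) :
    legAct (bmW (toSite rr) L R) b = axProjBmAt (toSite rr) L (legAct R b) := by
  funext κ u
  rw [legAct_apply, axProjBmAt_eq_coProjBmW' hL hrr]
  simp only [bmW]
  rw [sum_tsum_mul_coProjBmW (toSite rr) L hb hR κ u]
  rfl

/-! ## §3 One dressed step on an exact datum, closed form: `legAct (respStepBm ρ Lc (Lc^m) (Lc^(m+1))) (dz ψ) = (Lc^{d+1})⁻¹ • dz (ψ ∘ blk Lc)` -/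

/-- [folklore] `dz` commutes with scalars. -/
theorem dz_const_mul (c : ℝ) (f : Form0 (d + 1) ℝ) : dz (fun x => c * f x) = c • dz f := by
  funext κ x
  simp only [dz, Pi.smul_apply, smul_eq_mul]
  ring

/-- [folklore] `dz` is additive (differences). -/
theorem dz_sub' (f g : Form0 (d + 1) ℝ) : dz (f - g) = dz f - dz g := by
  funext κ x
  simp only [dz, Pi.sub_apply]
  ring

/-- [folklore] `dz 0 = 0`. -/
theorem dz_zero' : dz (0 : Form0 (d + 1) ℝ) = 0 := by
  funext κ x
  simp [dz]

/-- [folklore] Iterated block indices: `blk L (blk M x) = blk (M·L) x`. -/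
theorem blk_blk (L M : ℕ) (x : Site (d + 1)) : blk L (blk M x) = blk (M * L) x := by
  funext i
  simp only [blk]
  push_cast
  exact Int.ediv_ediv_of_nonneg (Int.natCast_nonneg M)

section OneStep

variable {Lc : ℕ} [NeZero Lc]

/-- [folklore] **THE ONE-STEP CLOSED FORM** (in-block root, every level `m`, summable `ψ`): the dressed one-step response family of the literal in units maps the
exact coarse datum `d_c ψ` to the block-constant pure gauge `(Lc^{d+1})⁻¹ • d (ψ ∘ blk_{Lc})`:
`legAct (respStepBm ρ Lc (Lc^m) (Lc^(m+1))) (dz ψ) = ((Lc:ℝ)^(d+1))⁻¹ • dz (fun x => ψ (blk Lc x))` — gan24-p4's `RespStepBmGaugeLaw.dressedStep_exact_eq`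
(`L = Lc`, `M = Lc^m`, `N′ = Lc^(m+1)`), read in the `legAct` ∕ `respStepBm` vocabulary; no global potential, no Poincaré datum. -/
theorem legAct_respStepBm_dz {rr : Fin (d + 1) → ℕ} (hrr : rr ∈ box (d + 1) Lc) (m : ℕ) {ψ : Site (d + 1) → ℝ}
    (hψ : Summable ψ) :
    legAct (respStepBm (toSite rr) Lc (Lc ^ m) (Lc ^ (m + 1))) (dz ψ) = (((Lc : ℝ) ^ (d + 1))⁻¹) • dz (fun x => ψ (blk Lc x)) := by
  have hLc : 0 < Lc := Nat.pos_of_ne_zero (NeZero.ne Lc)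
  have h := dressedStep_exact_eq (N' := Lc ^ (m + 1)) (d := d) hLc hrr (pow_pos hLc m) (pow_succ Lc m) hψ
  have e : legAct (respStepBm (toSite rr) Lc (Lc ^ m) (Lc ^ (m + 1))) (dz ψ)
      = fun l'' w' => ∑ μ, ∑' z, dz ψ μ z * coProjBmW (toSite rr) Lc (respStep (d := d) (Lc ^ m) (Lc ^ (m + 1)) μ z) l'' w' := by
    funext l'' w'; rfl
  rw [e, h, ← dz_const_mul]

/-- [folklore] LEVELWISE LOCALISATION OF THE DRESSED ONE-STEP FAMILIES from that of the undressed ones (leaf-01's `legDecay_bmW`: the window keeps the rate). -/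
theorem legDecay_respStepBm_levels (hLc : 1 ≤ Lc) {rr : Fin (d + 1) → ℕ} (hrr : rr ∈ box (d + 1) Lc)
    (hD : ∀ j, ∃ C m : ℝ, 0 < m ∧ LegDecay (respStep (d := d) (Lc ^ j) (Lc ^ (j + 1))) Lc C m) (j : ℕ) :
    ∃ C m : ℝ, 0 < m ∧ LegDecay (respStepBm (toSite rr) Lc (Lc ^ j) (Lc ^ (j + 1))) Lc C m := by
  obtain ⟨C, m, hm, h⟩ := hD j
  exact ⟨_, m, hm, by rw [respStepBm_def]; exact legDecay_bmW hLc hrr h hm.le⟩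

/-- [folklore] **THE RESPONSE LEGS COMPOSE ALONG THE LEVELS UNDER `legAct`**: `legAct (respStep (Lc^i) (Lc^n)) (legAct (respStep (Lc^n) (Lc^(n+1))) b)
= legAct (respStep (Lc^i) (Lc^(n+1))) b` (§1 Fubini + leaf-12's semigroup law `legComp_respStep`; the one-step leg localised, the composite leg bounded). -/
theorem legAct_respStep_succ (hD : ∀ j, ∃ C m : ℝ, 0 < m ∧ LegDecay (respStep (d := d) (Lc ^ j) (Lc ^ (j + 1))) Lc C m)
    (i n : ℕ) {b : Form1 (d + 1) ℝ} (hb : ∀ μ, Summable (b μ)) :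
    legAct (respStep (d := d) (Lc ^ i) (Lc ^ n)) (legAct (respStep (d := d) (Lc ^ n) (Lc ^ (n + 1))) b)
      = legAct (respStep (d := d) (Lc ^ i) (Lc ^ (n + 1))) b := by
  obtain ⟨C₁, m₁, hm₁, h₁⟩ := hD n
  obtain ⟨C₂, h₂⟩ := exists_abs_respStep_le (N' := Lc ^ n) (d := d) (Lc ^ i)
  rw [← legAct_legComp h₁ hm₁ h₂ hb, legComp_respStep (L' := Lc) (pow_succ Lc n)]

/-! ## §4 Exact data through the chain of dressed legs -/

/-- [folklore] **AN EXACT DATUM THROUGH THE CHAIN OF DRESSED ONE-STEP LEGS** (levels `m₀, …, m₀+k`; in-block root; every undressed one-step response family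
localised at a positive rate; summable `ψ`):
`legAct (legChain D m₀ k) (dz ψ) = ((Lc:ℝ)^((d+1)(k+1)))⁻¹ • dz (ψ ∘ blk (Lc^(k+1)))`, `D j := respStepBm ρ Lc (Lc^j) (Lc^(j+1))`
(induction on `k`: §3 at the source level, §1 for the composition, `blk Lc ∘ blk (Lc^(k+1)) = blk (Lc^(k+2))`). -/
theorem legAct_legChain_dz {rr : Fin (d + 1) → ℕ} (hrr : rr ∈ box (d + 1) Lc)
    (hD : ∀ j, ∃ C m : ℝ, 0 < m ∧ LegDecay (respStep (d := d) (Lc ^ j) (Lc ^ (j + 1))) Lc C m) (m₀ : ℕ) :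
    ∀ (k : ℕ) {ψ : Site (d + 1) → ℝ}, Summable ψ →
      legAct (legChain (fun j => respStepBm (toSite rr) Lc (Lc ^ j) (Lc ^ (j + 1))) m₀ k) (dz ψ)
        = (((Lc : ℝ) ^ ((d + 1) * (k + 1)))⁻¹) • dz (fun x => ψ (blk (Lc ^ (k + 1)) x))
  | 0, ψ, hψ => by rw [legChain_zero, legAct_respStepBm_dz hrr m₀ hψ, zero_add, mul_one, pow_one]
  | k + 1, ψ, hψ => by
    have hLc : 1 ≤ Lc := Nat.one_le_iff_ne_zero.2 (NeZero.ne Lc)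
    have hDb := legDecay_respStepBm_levels hLc hrr hD
    obtain ⟨C₁, m₁, hm₁, h₁⟩ := hDb (m₀ + k + 1)
    obtain ⟨C₂, m₂, hm₂, h₂⟩ := legDecay_legChain hDb m₀ k
    rw [legChain_succ, legAct_legComp h₁ hm₁ (fun lam v κ u => h₂.abs_le hm₂.le lam v κ u) (fun μ => summable_dz hψ μ),
      legAct_respStepBm_dz hrr (m₀ + k + 1) hψ, legAct_smul, legAct_legChain_dz hrr hD m₀ k (summable_comp_blk' hLc hψ), smul_smul]
    congr 1
    · rw [← mul_inv, ← pow_add]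
      congr 2
      ring
    · simp only [blk_blk, ← pow_succ]

end OneStep

end Summit.QuantumFields.BalabanUV.Beta.GAN24.RespStepBmDecomp

end
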